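import Mathlib
import Summits.NavierStokesRegularity.NavierStokesRegularity.Theorems.EulerZoomLiouvillePowerGaugeEulerLiouvilleSelfSimilarBadSetThin
import Summits.NavierStokesRegularity.NavierStokesRegularity.Theorems.EulerZoomLiouvillePowerGaugeEulerLiouvilleSelfSimilarNoDriftBounded
import Summits.NavierStokesRegularity.NavierStokesRegularity.Theorems.EulerZoomLiouvillePowerGaugeEulerLiouvilleSelfSimilarBoundedLiouville
import Summits.NavierStokesRegularity.NavierStokesRegularity.Theorems.EulerZoomLiouvillePowerGaugeEulerLiouvilleSelfSimilarTopBadNode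
import HarnessLib.Audit

/-!
# Rung C1 of the crux `EulerZoomLiouville.PowerGaugeEulerLiouville`: THE CLASSICAL STRATUM WITHOUT THE FAR FIELD —
# a smooth bounded self-similar Euler profile with bounded gradient and pressure bounded above is trivial (0 < γ < ½)

Route №10 `EulerZoomLiouville` (NavierStokesRegularity), crux E = stmt-NavierStokesRegularity-19832, tenure rung C1,
registered residue `stub_selfSimilarExtremalRest`.  Lineage ns-typeII-p2 (gen 7), on top of the three-lineage chain
closed by ns-typeII-p3 g8 (`Kelvin.eq_zero_of_smooth_of_farField`, CIV far field (3.8)).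

* **`eq_zero_of_smooth_of_bounded`** — `(V, P)` a self-similar Euler profile (CIV (3.3)), `V` smooth with
  `‖V‖ ≤ M`, `‖DV‖ ≤ K`, `P ≤ P₀`, exponent `0 < γ < ½` ⇒ `V ≡ 0`.  Chain: every vortical backward similarity
  trajectory converges to one BAD node (`tendsto_flow_atBot_of_curl_ne_zero_of_bounded`, p1's trajectory-level
  limit-set kill + the no-drift theorem); the bad set is compact (`𝒩_W ⊆ B̄(0, M/γ)`, p1's `isClosed_badSet`) and every
  bad node is thin (p3's `exists_trappedSet_null_of_bad`), so its backward basin is null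
  (p3's `volume_setOf_tendsto_flow_atBot_mem_eq_zero_of_trappedSets`); `{curl V ≠ 0}` is open and null, hence empty;
  a bounded irrotational profile with `P ≤ P₀` vanishes (`eq_zero_of_curl_eq_zero_of_bounded`).
* p3's (3.8) theorem `Kelvin.eq_zero_of_smooth_of_farField` is the special case `M = K = C₀`,
  `P₀ = P 0 + C₀(1+C₀)γ/(1−2γ)` (`norm_le_const_of_farField`, `norm_fderiv_le_const_of_farField`,
  `pressure_le_of_hasSelfSimilarFarFieldWith`) — not restated here (dedup).
* **`selfSimilar_ae_eq_zero_of_smooth_of_bounded`** — member level, any `ρ > 0` (`γ = 1/(2+ρ)`): an exactly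
  self-similar member whose profile is such a bounded classical profile vanishes a.e. on `(−∞,0) × ℝ³` — the
  «bounded classical profile» stratum of `stub_selfSimilarExtremalRest`, FILLED (reshape note: tenure STATUS 21:2xZ).

WHAT THIS IS NOT: not NS, not E, not rung C1 — smooth bounded profiles; the weak class (and unbounded / rough
profiles) untouched. [folklore; ConstantinIgnatovaVicol2026Putative §3 (setting); the chain's files for the mechanism]
-/

noncomputable section

-- flat `Theorems/<Route><Decl>…` files of one crux share the namespace of the crux (tree convention)
set_option linter.dupNamespace false

open MeasureTheory Set Filter Topology Metric Function InnerProductSpace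
open scoped RealInnerProductSpace NNReal ContDiff

namespace Summit.NavierStokesRegularity.NavierStokesRegularity.Theorems.PowerGaugeEulerLiouville.NoDrift

open Literature.Analysis Literature.Analysis.FluidPDE
open Summit.NavierStokesRegularity.NavierStokesRegularity.Theorems.PowerGaugeEulerLiouville.Kelvin

variable {γ : ℝ} {V : EuclideanSpace ℝ (Fin 3) → EuclideanSpace ℝ (Fin 3)} {P : EuclideanSpace ℝ (Fin 3) → ℝ}

/-- **The bad set of a bounded profile is compact**: `𝒩_W ⊆ B̄(0, M/γ)` (`γ z = −V z`), `𝒩_W` is closed, and the bad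
condition `∃ w, ‖w‖ = 1 ∧ 1 ≤ ⟪DV(z) w, w⟫` is closed (p1's `isClosed_badSet`). [folklore] -/
theorem isCompact_badNodalSet_of_bounded (hV : ContDiff ℝ ∞ V) (hprof : IsSelfSimilarEulerProfile γ 0 V P)
    (hγ : 0 < γ) {M : ℝ} (hM : ∀ y, ‖V y‖ ≤ M) :
    IsCompact {z : EuclideanSpace ℝ (Fin 3) | z ∈ selfSimilarNodalSet γ 0 V ∧
      ∃ w : EuclideanSpace ℝ (Fin 3), ‖w‖ = 1 ∧ 1 ≤ ⟪fderiv ℝ V z w, w⟫} := by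
  have hWc : Continuous (selfSimilarTransport γ 0 V) := (contDiff_selfSimilarTransport (γ := γ) hV).continuous
  have hNcl : IsClosed (selfSimilarNodalSet γ 0 V) := isClosed_eq hWc continuous_const
  have hNbdd : selfSimilarNodalSet γ 0 V ⊆ closedBall (0 : EuclideanSpace ℝ (Fin 3)) (M / γ) := by
    intro z hz
    rw [mem_selfSimilarNodalSet_iff, sub_zero] at hz
    have h1 : γ • z = -V z := eq_neg_of_add_eq_zero_left hz
    have h2 : γ * ‖z‖ = ‖V z‖ := by
      rw [← norm_neg (V z), ← h1, norm_smul, Real.norm_of_nonneg hγ.le]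
    rw [mem_closedBall, dist_zero_right, le_div_iff₀ hγ, mul_comm, h2]
    exact hM z
  have hcpt : IsCompact (selfSimilarNodalSet γ 0 V) := (isCompact_closedBall _ _).of_isClosed_subset hNcl hNbdd
  rw [setOf_and]
  exact hcpt.inter_right (NodalContinuum.isClosed_badSet hprof)

/-- **RUNG C1, THE BOUNDED CLASSICAL STRATUM — UNCONDITIONAL AND FAR-FIELD-FREE.**  A self-similar Euler profile
`(V, P)` (CIV (3.3)) with `V` smooth, `‖V‖ ≤ M`, `‖DV‖ ≤ K`, `P ≤ P₀` and exponent `0 < γ < ½` is trivial: `V ≡ 0`.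
[folklore; three-lineage chain of the ns-regularity-ideate cell (p1 limit-set kill, p2 no-drift, p3 thin bad nodes)] -/
theorem eq_zero_of_smooth_of_bounded (hV : ContDiff ℝ ∞ V) (hprof : IsSelfSimilarEulerProfile γ 0 V P) {M K P₀ : ℝ}
    (hM : ∀ y, ‖V y‖ ≤ M) (hK : ∀ y, ‖fderiv ℝ V y‖ ≤ K) (hP : ∀ y, P y ≤ P₀) (hγ : 0 < γ) (hγ2 : γ < 1 / 2) :
    V = 0 := by
  set B : Set (EuclideanSpace ℝ (Fin 3)) := {z | z ∈ selfSimilarNodalSet γ 0 V ∧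
    ∃ w : EuclideanSpace ℝ (Fin 3), ‖w‖ = 1 ∧ 1 ≤ ⟪fderiv ℝ V z w, w⟫} with hB
  have hBc : IsCompact B := isCompact_badNodalSet_of_bounded hV hprof hγ hM
  -- the backward basin of the bad set is null
  have hnull := volume_setOf_tendsto_flow_atBot_mem_eq_zero_of_trappedSets hV hK hBc
    fun z hz => exists_trappedSet_null_of_bad hV hK hprof hγ hγ2 hz.1 hz.2
  -- every vortical point lies in it
  have hsub : {x : EuclideanSpace ℝ (Fin 3) | curl V x ≠ 0} ⊆ {x : EuclideanSpace ℝ (Fin 3) | ∃ z ∈ B,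
      Tendsto (fun s => ODE.evolutionMap (fun _ : ℝ => selfSimilarTransport γ 0 V) 0 s x) atBot (𝓝 z)} := by
    intro x hx
    obtain ⟨z, hzN, hbad, hz⟩ := tendsto_flow_atBot_of_curl_ne_zero_of_bounded hV hK hprof hM hP hγ hγ2 hx
    exact ⟨z, ⟨hzN, hbad⟩, hz⟩
  -- an open null set is empty
  have hopen : IsOpen {x : EuclideanSpace ℝ (Fin 3) | curl V x ≠ 0} := by
    have hV2 : ContDiff ℝ 2 V := hV.of_le (by norm_cast)
    exact isOpen_ne_fun (differentiable_curl_of_contDiff hV2).continuous continuous_const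
  have hzero : volume {x : EuclideanSpace ℝ (Fin 3) | curl V x ≠ 0} = 0 := measure_mono_null hsub hnull
  have hempty : {x : EuclideanSpace ℝ (Fin 3) | curl V x ≠ 0} = ∅ := (hopen.measure_eq_zero_iff volume).1 hzero
  have hcurl : ∀ x, curl V x = 0 := by
    intro x
    by_contra hx
    have : x ∈ ({x : EuclideanSpace ℝ (Fin 3) | curl V x ≠ 0} : Set _) := hx
    rw [hempty] at this
    exact this
  exact eq_zero_of_curl_eq_zero_of_bounded hprof (by linarith) hM hP hcurl

/-- **Rung C1, the bounded classical stratum, MEMBER LEVEL.**  An exactly self-similar member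
`u(τ) = selfSimilarCollapse (1/(2+ρ)) 0 V τ` (`ρ > 0`) whose profile solves CIV (3.3) with `V` smooth bounded, `DV`
bounded and `P` bounded above vanishes a.e. on `(−∞, 0) × ℝ³` (indeed `V ≡ 0`).  Binder shape of the lineage's
member-level strata. [folklore] -/
theorem selfSimilar_ae_eq_zero_of_smooth_of_bounded {ρ : ℝ} (hρ : 0 < ρ)
    (u : ℝ → EuclideanSpace ℝ (Fin 3) → EuclideanSpace ℝ (Fin 3))
    (hu : ∀ τ : ℝ, τ < 0 → u τ = selfSimilarCollapse (1 / (2 + ρ)) 0 V τ)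
    (hV : ContDiff ℝ ∞ V) (hprof : IsSelfSimilarEulerProfile (1 / (2 + ρ)) 0 V P) {M K P₀ : ℝ}
    (hM : ∀ y, ‖V y‖ ≤ M) (hK : ∀ y, ‖fderiv ℝ V y‖ ≤ K) (hP : ∀ y, P y ≤ P₀) :
    uncurry u =ᵐ[volume.restrict (Iio (0 : ℝ) ×ˢ (univ : Set (EuclideanSpace ℝ (Fin 3))))] 0 := by
  have h2ρ : (0 : ℝ) < 2 + ρ := by linarith
  have hγ : (0 : ℝ) < 1 / (2 + ρ) := one_div_pos.2 h2ρ
  have hγ2 : 1 / (2 + ρ) < 1 / 2 := one_div_lt_one_div_of_lt two_pos (by linarith)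
  exact selfSimilar_ae_eq_zero_of_profile_eq_zero u hu (eq_zero_of_smooth_of_bounded hV hprof hM hK hP hγ hγ2)

end Summit.NavierStokesRegularity.NavierStokesRegularity.Theorems.PowerGaugeEulerLiouville.NoDrift

end
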